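import Mathlib
import HarnessLib
import Summits.Ventures.LatticeQCDFlow.Exactness.NCMCGeneralSpaceOccupancyChainMeans
import Summits.Ventures.LatticeQCDFlow.Exactness.NCMCGeneralSpaceOccupancyChainHeatBath

/-!
# End to end: the NCMC chain watched on the target level estimates target expectations — minorised level samplers, heat-bath scans, torus Wilson loops

HONEST FRAMING: exact (Metropolis-corrected) sampling algorithms for lattice gauge theory;
figures of merit are autocorrelation/cost numbers at stated couplings and volumes; no
continuum-physics claim.

Venture `LatticeQCDFlow` (cell pub-lqcd), topic `Exactness`; FANOUT row 13 (`eng-snf`, GEN-17).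
NEW WORK of the cell, not a published result; no definition is introduced; nothing is cited as a
fact.  ASSEMBLY of `NCMCGeneralSpaceOccupancyChainMeans.lean` (target- and prior-level ratio
averages are consistent along an ERGODIC expanded-ensemble chain) with the certificate
`NCMCGeneralSpaceOccupancyChainErgodic.lean` (minorised invariant level samplers ⇒ ergodic) and the
heat-bath packages of `NCMCGeneralSpaceOccupancyChainHeatBath.lean` /
`NCMCGeneralSpaceWilsonHeatBathBar.lean`.  This is the engine's `snf.ncmc.target_means`: plain
averages of an observable over the iterations the chain spends on the target level.

## Content

* §1 **`CrooksPair.tendsto_targetLevelMean_ae_ncmcChain`** /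
  **`CrooksPair.tendsto_priorLevelMean_ae_ncmcChain`** — Crooks pair between finite non-zero level
  weights, level samplers `T₀`, `T₁` leaving `ν₀`, `ν₁` invariant and minorised by non-zero measures,
  ANY `c`, any measurable `g ∈ L¹(ν₁)` (`L¹(ν₀)`): along the chain of
  `switchKernel ∘ₖ levelKernel T₀ T₁` started in `π_c`,
  `Σ_{i<n, target} g(x_i) / #{i<n : target} → Z₁⁻¹ ∫ g dν₁` (resp. `→ Z₀⁻¹ ∫ g dν₀` on the prior
  level) almost surely — unconditionally.
* §2 **`CrooksPair.ncmc_heatBath_targetMean`** — the defect / boundary-condition shape: two bounded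
  densities `p₀ · ⊗μ`, `p₁ · ⊗μ` on a finite product of probability spaces, heat-bath scans as level
  samplers: target-level averages of any measurable `g ∈ L¹(p₁ · ⊗μ)` converge to the normalised
  target expectation a.s.
* §3 **`CrooksPair.ncmc_wilsonHeatBath_targetMean`** — the coupling shape: torus Wilson theory,
  compact second-countable `G`, continuous `ρ`, prior `wilsonWeight ρ β₀`, target `wilsonWeight ρ β₁`,
  heat-bath link sweeps: for every CONTINUOUS observable `g` (Wilson loops, Polyakov loops, the
  plaquette) the target-level average converges to `⟨g⟩_{β₁} = Z_{β₁}⁻¹ ∫ g d(wilsonWeight ρ β₁)`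
  almost surely.

NOT CLAIMED: rates or error bars for these ratio estimators; over-relaxation / Cabibbo–Marinari
level samplers (same certificate, not assembled here); anything numerical.
-/

namespace Summit.Ventures.LatticeQCDFlow.Exactness.GeneralNCMC

open MeasureTheory ProbabilityTheory Set Filter Finset
open scoped ENNReal Topology

/-! ## §1 Under the certificate: minorised invariant level samplers -/

section Certificate

variable {Ω E : Type*} [MeasurableSpace Ω] [MeasurableSpace E]
variable {ν₀ ν₁ : Measure Ω} [IsFiniteMeasure ν₀] [IsFiniteMeasure ν₁] {κF κR : Kernel Ω E}
  [IsMarkovKernel κF] [IsMarkovKernel κR] {s e : E → Ω} {W : E → ℝ} {T₀ T₁ : Kernel Ω Ω}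
  [IsMarkovKernel T₀] [IsMarkovKernel T₁] {m₀ m₁ : Measure Ω} [IsFiniteMeasure m₀] [IsFiniteMeasure m₁]

/-- **TARGET-LEVEL AVERAGES CONVERGE TO TARGET EXPECTATIONS, UNCONDITIONALLY.**  For a Crooks pair
between finite non-zero level weights, level samplers leaving their weights invariant and minorised
by non-zero measures, ANY `c` and any measurable `g ∈ L¹(ν₁)`: along the engine's expanded-ensemble
chain the plain average of `g` over the target-level visits converges to `Z₁⁻¹ ∫ g dν₁` a.s. -/
theorem CrooksPair.tendsto_targetLevelMean_ae_ncmcChain (h : CrooksPair ν₀ ν₁ κF κR s e W)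
    (h0 : ν₀ univ ≠ 0) (h1 : ν₁ univ ≠ 0) (hT₀ : Kernel.Invariant T₀ ν₀)
    (hT₁ : Kernel.Invariant T₁ ν₁) (hm₀ : m₀ univ ≠ 0) (hm₁ : m₁ univ ≠ 0) (hmin₀ : ∀ z, m₀ ≤ T₀ z)
    (hmin₁ : ∀ z, m₁ ≤ T₁ z) (c : ℝ) {g : Ω → ℝ} (hgm : Measurable g) (hg : Integrable g ν₁) :
    haveI := isMarkovKernel_switchKernel (κF := κF) (κR := κR) (c := c)
      h.measurable_W h.measurable_s h.measurable_e
    haveI := isMarkovKernel_levelKernel T₀ T₁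
    haveI := isProbabilityMeasure_jointLaw c ν₀ ν₁ h0
    ∀ᵐ z ∂(Kernel.trajMeasure (X := fun _ : ℕ => Bool × Ω)
        ((jointWeight c ν₀ ν₁ univ)⁻¹ • jointWeight c ν₀ ν₁)
        (fun n : ℕ => (switchKernel κF κR c W s e ∘ₖ levelKernel T₀ T₁).comap
          (fun hh : (j : ↥(Finset.Iic n)) → Bool × Ω => hh ⟨n, Finset.mem_Iic.2 le_rfl⟩)
          (measurable_pi_apply _))),
      Tendsto (fun n : ℕ =>
          (∑ i ∈ range n, (targetLevel Ω).indicator (fun p : Bool × Ω => g p.2) (z i)) /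
            ∑ i ∈ range n, (targetLevel Ω).indicator (1 : Bool × Ω → ℝ) (z i))
        atTop (𝓝 (((ν₁ univ).toReal)⁻¹ * ∫ y, g y ∂ν₁)) := by
  haveI := isMarkovKernel_switchKernel (κF := κF) (κR := κR) (c := c)
    h.measurable_W h.measurable_s h.measurable_e
  haveI := isMarkovKernel_levelKernel T₀ T₁
  exact tendsto_targetLevelMean_ae_chain _ h0 h1 (iteration_invariant h hT₀ hT₁ c)
    (h.ergodic_ncmcChain h0 h1 hT₀ hT₁ hm₀ hm₁ hmin₀ hmin₁ c) hgm hg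

/-- **PRIOR-LEVEL AVERAGES CONVERGE TO PRIOR EXPECTATIONS, UNCONDITIONALLY**: the same on the
prior level, limit `Z₀⁻¹ ∫ g dν₀`, for any measurable `g ∈ L¹(ν₀)`. -/
theorem CrooksPair.tendsto_priorLevelMean_ae_ncmcChain (h : CrooksPair ν₀ ν₁ κF κR s e W)
    (h0 : ν₀ univ ≠ 0) (h1 : ν₁ univ ≠ 0) (hT₀ : Kernel.Invariant T₀ ν₀)
    (hT₁ : Kernel.Invariant T₁ ν₁) (hm₀ : m₀ univ ≠ 0) (hm₁ : m₁ univ ≠ 0) (hmin₀ : ∀ z, m₀ ≤ T₀ z)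
    (hmin₁ : ∀ z, m₁ ≤ T₁ z) (c : ℝ) {g : Ω → ℝ} (hgm : Measurable g) (hg : Integrable g ν₀) :
    haveI := isMarkovKernel_switchKernel (κF := κF) (κR := κR) (c := c)
      h.measurable_W h.measurable_s h.measurable_e
    haveI := isMarkovKernel_levelKernel T₀ T₁
    haveI := isProbabilityMeasure_jointLaw c ν₀ ν₁ h0
    ∀ᵐ z ∂(Kernel.trajMeasure (X := fun _ : ℕ => Bool × Ω)
        ((jointWeight c ν₀ ν₁ univ)⁻¹ • jointWeight c ν₀ ν₁)
        (fun n : ℕ => (switchKernel κF κR c W s e ∘ₖ levelKernel T₀ T₁).comap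
          (fun hh : (j : ↥(Finset.Iic n)) → Bool × Ω => hh ⟨n, Finset.mem_Iic.2 le_rfl⟩)
          (measurable_pi_apply _))),
      Tendsto (fun n : ℕ =>
          (∑ i ∈ range n, (targetLevel Ω)ᶜ.indicator (fun p : Bool × Ω => g p.2) (z i)) /
            ∑ i ∈ range n, (targetLevel Ω)ᶜ.indicator (1 : Bool × Ω → ℝ) (z i))
        atTop (𝓝 (((ν₀ univ).toReal)⁻¹ * ∫ x, g x ∂ν₀)) := by
  haveI := isMarkovKernel_switchKernel (κF := κF) (κR := κR) (c := c)
    h.measurable_W h.measurable_s h.measurable_e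
  haveI := isMarkovKernel_levelKernel T₀ T₁
  exact tendsto_priorLevelMean_ae_chain _ h0 (iteration_invariant h hT₀ hT₁ c)
    (h.ergodic_ncmcChain h0 h1 hT₀ hT₁ hm₀ hm₁ hmin₀ hmin₁ c) hgm hg

end Certificate

/-! ## §2 Two bounded densities against one product reference, heat-bath scans -/

section HeatBath

variable {ι : Type*} [Fintype ι] [DecidableEq ι] {X : ι → Type*} [∀ i, MeasurableSpace (X i)]
variable {μ : Π i, Measure (X i)} [∀ i, IsProbabilityMeasure (μ i)]

/-- **THE DEFECT / BOUNDARY-CONDITION SHAPE: target-level averages.**  Prior weight `p₀ · ⊗μ`,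
target weight `p₁ · ⊗μ` (`0 < m_k ≤ p_k ≤ M_k < ∞`), heat-bath scans for `p₀` / `p₁` over lists
visiting every site as level samplers, ANY Crooks pair between the two weights, ANY `c`, any
measurable `g ∈ L¹(p₁ · ⊗μ)`: along the expanded-ensemble chain started in `π_c` the plain average
of `g` over the target-level visits converges to `Z₁⁻¹ ∫ g p₁ d⊗μ` almost surely. -/
theorem CrooksPair.ncmc_heatBath_targetMean {p₀ p₁ : (Π j, X j) → ℝ≥0∞} {m₀ M₀ m₁ M₁ : ℝ≥0∞}
    (hp₀ : Measurable p₀) (hm₀0 : m₀ ≠ 0) (hM₀ : M₀ ≠ ∞) (hmp₀ : ∀ ω, m₀ ≤ p₀ ω)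
    (hpM₀ : ∀ ω, p₀ ω ≤ M₀) {l₀ : List ι} (hl₀ : ∀ i, i ∈ l₀)
    (hp₁ : Measurable p₁) (hm₁0 : m₁ ≠ 0) (hM₁ : M₁ ≠ ∞) (hmp₁ : ∀ ω, m₁ ≤ p₁ ω)
    (hpM₁ : ∀ ω, p₁ ω ≤ M₁) {l₁ : List ι} (hl₁ : ∀ i, i ∈ l₁)
    {E : Type*} [MeasurableSpace E] {κF κR : Kernel (Π j, X j) E} [IsMarkovKernel κF]
    [IsMarkovKernel κR] {s e : E → Π j, X j} {W : E → ℝ}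
    (h : CrooksPair ((Measure.pi μ).withDensity p₀) ((Measure.pi μ).withDensity p₁) κF κR s e W)
    (c : ℝ) {g : (Π j, X j) → ℝ} (hgm : Measurable g)
    (hg : Integrable g ((Measure.pi μ).withDensity p₁)) :
    ∃ (_ : IsMarkovKernel (switchKernel κF κR c W s e))
      (_ : IsMarkovKernel (levelKernel (cycle (l₀.map (siteHeatBath μ p₀)))
        (cycle (l₁.map (siteHeatBath μ p₁)))))
      (_ : IsProbabilityMeasure ((jointWeight c ((Measure.pi μ).withDensity p₀)
        ((Measure.pi μ).withDensity p₁) univ)⁻¹ •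
        jointWeight c ((Measure.pi μ).withDensity p₀) ((Measure.pi μ).withDensity p₁))),
      ∀ᵐ z ∂(Kernel.trajMeasure (X := fun _ : ℕ => Bool × (Π j, X j))
          ((jointWeight c ((Measure.pi μ).withDensity p₀) ((Measure.pi μ).withDensity p₁) univ)⁻¹ •
            jointWeight c ((Measure.pi μ).withDensity p₀) ((Measure.pi μ).withDensity p₁))
          (fun n : ℕ => (switchKernel κF κR c W s e ∘ₖ
            levelKernel (cycle (l₀.map (siteHeatBath μ p₀))) (cycle (l₁.map (siteHeatBath μ p₁)))).comap
            (fun hh : (j : ↥(Finset.Iic n)) → Bool × (Π j, X j) => hh ⟨n, Finset.mem_Iic.2 le_rfl⟩)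
            (measurable_pi_apply _))),
        Tendsto (fun n : ℕ =>
            (∑ i ∈ range n,
                (targetLevel (Π j, X j)).indicator (fun q : Bool × (Π j, X j) => g q.2) (z i)) /
              ∑ i ∈ range n, (targetLevel (Π j, X j)).indicator (1 : Bool × (Π j, X j) → ℝ) (z i))
          atTop (𝓝 (((((Measure.pi μ).withDensity p₁) univ).toReal)⁻¹ *
            ∫ y, g y ∂((Measure.pi μ).withDensity p₁))) := by
  obtain ⟨hMk₀, hfin₀, mm₀, hmfin₀, h0, hm₀, hK₀, hmin₀⟩ := heatBathSweep_package (μ := μ) hp₀ hm₀0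
    hM₀ hmp₀ hpM₀ hl₀
  obtain ⟨hMk₁, hfin₁, mm₁, hmfin₁, h1, hm₁, hK₁, hmin₁⟩ := heatBathSweep_package (μ := μ) hp₁ hm₁0
    hM₁ hmp₁ hpM₁ hl₁
  haveI := hMk₀
  haveI := hMk₁
  haveI := hfin₀
  haveI := hfin₁
  haveI := hmfin₀
  haveI := hmfin₁
  exact ⟨isMarkovKernel_switchKernel (κF := κF) (κR := κR) (c := c)
      h.measurable_W h.measurable_s h.measurable_e,
    isMarkovKernel_levelKernel _ _, isProbabilityMeasure_jointLaw c _ _ h0,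
    h.tendsto_targetLevelMean_ae_ncmcChain h0 h1 hK₀ hK₁ hm₀ hm₁ hmin₀ hmin₁ c hgm hg⟩

end HeatBath

/-! ## §3 Two torus Wilson couplings: continuous observables on the target level -/

section Wilson

open Literature.MathematicalPhysics.QuantumFieldTheory

variable {d L N : ℕ} {G : Type*} [Group G] [TopologicalSpace G] [IsTopologicalGroup G]
  (ρ : G →* Matrix (Fin N) (Fin N) ℂ) [CompactSpace G] [MeasurableSpace G] [BorelSpace G]
  [SecondCountableTopology G]

/-- **THE COUPLING SHAPE: target-level averages of continuous observables.**  Torus Wilson theory,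
compact second-countable `G`, continuous `ρ`, `L ≠ 0`; prior `wilsonWeight ρ β₀`, target
`wilsonWeight ρ β₁`, heat-bath link sweeps at `β₀` / `β₁` over edge lists visiting every edge as
level samplers; for EVERY Crooks pair between the two weights, EVERY `c` and every CONTINUOUS
observable `g` of the gauge field (Wilson / Polyakov loops, the plaquette): along the
expanded-ensemble chain started in `π_c`, the plain average of `g` over the target-level visits
converges to `⟨g⟩_{β₁} = Z_{β₁}⁻¹ ∫ g d(wilsonWeight ρ β₁)` almost surely. -/
theorem CrooksPair.ncmc_wilsonHeatBath_targetMean [NeZero L] (hρ : Continuous ρ) (β₀ β₁ : ℝ)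
    {l₀ l₁ : List (Edge d L)} (hl₀ : ∀ ed, ed ∈ l₀) (hl₁ : ∀ ed, ed ∈ l₁)
    {E : Type*} [MeasurableSpace E] {κF κR : Kernel (GaugeConfig d L G) E} [IsMarkovKernel κF]
    [IsMarkovKernel κR] {s e : E → GaugeConfig d L G} {W : E → ℝ}
    (h : CrooksPair (wilsonWeight (d := d) (L := L) ρ β₀) (wilsonWeight (d := d) (L := L) ρ β₁)
      κF κR s e W) (c : ℝ) {g : GaugeConfig d L G → ℝ} (hg : Continuous g) :
    ∃ (_ : IsMarkovKernel (switchKernel κF κR c W s e))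
      (_ : IsMarkovKernel (levelKernel
        (cycle (l₀.map (siteHeatBath (fun _ : Edge d L => haarProbability G)
          (gibbsDensity fun U : GaugeConfig d L G => β₀ * wilsonAction ρ U))))
        (cycle (l₁.map (siteHeatBath (fun _ : Edge d L => haarProbability G)
          (gibbsDensity fun U : GaugeConfig d L G => β₁ * wilsonAction ρ U))))))
      (_ : IsProbabilityMeasure ((jointWeight c (wilsonWeight (d := d) (L := L) ρ β₀)
        (wilsonWeight (d := d) (L := L) ρ β₁) univ)⁻¹ •
        jointWeight c (wilsonWeight (d := d) (L := L) ρ β₀) (wilsonWeight (d := d) (L := L) ρ β₁))),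
      ∀ᵐ z ∂(Kernel.trajMeasure (X := fun _ : ℕ => Bool × GaugeConfig d L G)
          ((jointWeight c (wilsonWeight (d := d) (L := L) ρ β₀)
            (wilsonWeight (d := d) (L := L) ρ β₁) univ)⁻¹ •
            jointWeight c (wilsonWeight (d := d) (L := L) ρ β₀) (wilsonWeight (d := d) (L := L) ρ β₁))
          (fun n : ℕ => (switchKernel κF κR c W s e ∘ₖ levelKernel
            (cycle (l₀.map (siteHeatBath (fun _ : Edge d L => haarProbability G)
              (gibbsDensity fun U : GaugeConfig d L G => β₀ * wilsonAction ρ U))))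
            (cycle (l₁.map (siteHeatBath (fun _ : Edge d L => haarProbability G)
              (gibbsDensity fun U : GaugeConfig d L G => β₁ * wilsonAction ρ U))))).comap
            (fun hh : (j : ↥(Finset.Iic n)) → Bool × GaugeConfig d L G =>
              hh ⟨n, Finset.mem_Iic.2 le_rfl⟩) (measurable_pi_apply _))),
        Tendsto (fun n : ℕ =>
            (∑ i ∈ range n, (targetLevel (GaugeConfig d L G)).indicator
                (fun q : Bool × GaugeConfig d L G => g q.2) (z i)) /
              ∑ i ∈ range n, (targetLevel (GaugeConfig d L G)).indicator
                (1 : Bool × GaugeConfig d L G → ℝ) (z i))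
          atTop (𝓝 ((((wilsonWeight (d := d) (L := L) ρ β₁) univ).toReal)⁻¹ *
            ∫ U, g U ∂(wilsonWeight (d := d) (L := L) ρ β₁))) := by
  obtain ⟨hMk₀, hfin₀, m₀, hmfin₀, h0, hm₀, hK₀, hmin₀⟩ := wilson_heatBathSweep_package ρ hρ β₀ hl₀
  obtain ⟨hMk₁, hfin₁, m₁, hmfin₁, h1, hm₁, hK₁, hmin₁⟩ := wilson_heatBathSweep_package ρ hρ β₁ hl₁
  haveI := hMk₀
  haveI := hMk₁
  haveI := hfin₀
  haveI := hfin₁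
  haveI := hmfin₀
  haveI := hmfin₁
  -- a continuous observable of the compact gauge field is bounded, hence integrable
  haveI : Nonempty (GaugeConfig d L G) := ⟨fun _ => 1⟩
  obtain ⟨ωb, -, hmax⟩ := isCompact_univ.exists_isMaxOn Set.univ_nonempty hg.norm.continuousOn
  have hgi : Integrable g (wilsonWeight (d := d) (L := L) ρ β₁) :=
    Integrable.of_bound hg.measurable.aestronglyMeasurable ‖g ωb‖
      (Eventually.of_forall fun U => (isMaxOn_iff.1 hmax) U (Set.mem_univ U))
  exact ⟨isMarkovKernel_switchKernel (κF := κF) (κR := κR) (c := c)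
      h.measurable_W h.measurable_s h.measurable_e,
    isMarkovKernel_levelKernel _ _, isProbabilityMeasure_jointLaw c _ _ h0,
    h.tendsto_targetLevelMean_ae_ncmcChain h0 h1 hK₀ hK₁ hm₀ hm₁ hmin₀ hmin₁ c hg.measurable hgi⟩

end Wilson

end Summit.Ventures.LatticeQCDFlow.Exactness.GeneralNCMC
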